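import Literature.NumberTheory.EllipticCurves.KimNakamura2020.RankZeroShaBound
import Literature.NumberTheory.EllipticCurves.Kato2004.Condition1252
import Summits.BirchSwinnertonDyer.Rank1Residual.Additive.X4RankZeroUpperBound
import Literature.NumberTheory.EllipticCurves.BSDSelmerPConverseRamifiedProofs
import Literature.NumberTheory.EllipticCurves.Rank1Residual.Typed.CasselsLowerBound
import HarnessLib

/-!
# X4 at `p = 3`, analytic rank `0`: the UPPER bound `ord₃ #Ш ≤ ord₃ #Ш_an + ord₃ Tam` from Kim–Nakamura 2020 at an ADDITIVE `3`, and `BSD(E,3)` on the unit rows (cell `b2b-bsdres`; drafted by the literature seat lit-kato gen 2, landed and extended by the X4♯ owner additive-p4 gen 12 — companion of `X4RankZeroKatoBound.lean` (Kato 14.5 (3) route, potentially good rows); this KN20 route also covers the POTENTIALLY MULTIPLICATIVE additive rows, at the price of KN20's provisos (non-exceptional, `3 ∤ ∏_{ℓ‖N}(ℓ ∓ 1)`))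

HONEST FRAMING (cell `b2b-bsdres`, verbatim): the goal of the cell is to DELETE the COMBINATION-SHAPED residual
classes of the BSD formula for ALL analytic-rank `≤ 1` elliptic curves over `ℚ` — assembled STRICTLY from published
theorems — so that the rank-`≤ 1` remainder becomes exactly the CONSTRUCTION-SHAPED classes, which are TYPED, NOT
attempted. This is not "finishing BSD". Research route on the construction-shaped class X4; no claim beyond the
stated rows; labels UNCHANGED; nothing booked.

Port of `Additive/X4RankZeroUpperBound.lean` (Kim 2026, `p ≥ 5`) to `p = 3` on the named fact
`KimNakamura2020.rankZero_padicValNat_sha_le_of_maninConstant` (Kim–Nakamura, J. Number Theory 210 (2020), Thm 1.7 +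
Rem 1.8 (1), inequality form; tree file `KimNakamura2020/RankZeroShaBound.lean`, p239892) with the `3`-adic surjectivity
fed by `surj(9)` (`WeierstrassCurve.forall_hasSurjectiveModNGaloisRep_three_pow_of_nine`, `Kato2004/Condition1252.lean`,
p239456). Theorems only; no definition; no new named fact. additive-p4's additions to the port: the typed upper half
(`X4RankZero.missingUpperBoundAt_three_of_kimNakamura`), the census-shape variant with the `3`-adic surjectivity fed by
surj(3) ∧ ram(3) instead of surj(9) (`X4RankZero.bsdp_three_of_kimNakamura_of_ram_of_shaAn_unit`, tree theorem
`hasSurjectiveModNGaloisRep_pow_of_hasMultiplicativeReductionAtPrime`), and the Cassels–Tate squeeze on the `3 ∣ #Ш_an` rows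
(`X4RankZero.bsdp_three_of_kimNakamura_of_casselsTate`). CENSUS (additive-p4 engine A over hyp's two-engine bits, window
N < 2·10⁴; `HOME/b2b-bsdres-additive-p4/V20-CENSUS-engineA.tsv`, columns nonexc3 / S_imprim): of the 1582 ‖ 417 X4♯(3) unit rows,
240 satisfy ram ∧ NonExceptional ∧ `3 ∤ ∏(ℓ ∓ 1)` — 161 of them potentially good (also covered by the Kato route) and **79
potentially multiplicative (covered ONLY by this route)**; union of the two routes on the window: 945 rows. Per pair; labels
unchanged; nothing booked.
-/

noncomputable section

namespace Summit.BirchSwinnertonDyer.Rank1Residual.Additive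

open scoped Classical
open WeierstrassCurve Literature.NumberTheory.EllipticCurves
  Literature.NumberTheory.EllipticCurves.ModularForms
  Literature.NumberTheory.EllipticCurves.Rank1Residual
  Literature.NumberTheory.EllipticCurves.Rank1Residual.Typed

variable (W : WeierstrassCurve ℚ) [W.IsElliptic] [W.IsGloballyMinimal] (p : ℕ) [Fact p.Prime]

/-- PORT of `padicValNat_shaOrder_le_of_kim_rankZero`: class-agnostic rank-0 upper bound at an ADDITIVE odd `p`
(any odd `p` outside the KP-exceptional cases; `p`-adic surjectivity) from the KN20 fact. -/
theorem padicValNat_shaOrder_le_of_kimNakamura_rankZero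
    (hKN : KimNakamura2020.rankZero_padicValNat_sha_le_of_maninConstant)
    (hGZK : rank_eq_analyticRank_of_analyticRank_le_one) (hmod : hasEntireLFunction_rat)
    (hp2 : p ≠ 2) (hadd : ¬ W.HasGoodReductionAtPrime p ∧ ¬ W.HasMultiplicativeReductionAtPrime p)
    (hexc : 7 < p ∨ KimNakamura2020.NonExceptional W p)
    (hr : W.analyticRank = 0) (hsurj : ∀ n : ℕ, W.HasSurjectiveModNGaloisRep (p ^ n : ℕ))
    (htam : ¬ p ∣ W.tamagawaProduct)
    (hmult : ∀ (ℓ : ℕ) [Fact ℓ.Prime], W.HasMultiplicativeReductionAtPrime ℓ →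
      (W.HasSplitMultiplicativeReductionAtPrime ℓ → ¬ p ∣ ℓ - 1) ∧
        (¬ W.HasSplitMultiplicativeReductionAtPrime ℓ → ¬ p ∣ ℓ + 1))
    {N : ℕ} [NeZero N] (D : ModularParametrizationData W N) (hc : ¬ (p : ℤ) ∣ D.maninConstant) :
    ∃ q : ℚ, shaAn W = (q : ℂ) ∧
      (padicValNat p W.shaOrder : ℤ) ≤
        padicValRat p q + padicValNat p W.tamagawaProduct - 2 * padicValNat p W.torsionOrder := by
  have hL : W.entireLFunction 1 ≠ 0 := (W.analyticRank_eq_zero_iff_holds (hmod W)).mp hr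
  obtain ⟨hmw, hfin⟩ := hGZK W (by rw [hr]; exact zero_le_one)
  haveI : Finite W.sha := hfin
  have hmw0 : W.mordellWeilRank = 0 := by rw [hmw, hr]
  obtain ⟨q₀, hq₀, hle⟩ := hKN W p hp2 hadd.1 hadd.2 hexc hsurj htam hmult hL hfin D hc
  have hΩpos : 0 < W.realPeriodRat := W.realPeriodRat_pos_holds
  have hΩ : (W.realPeriodRat : ℂ) ≠ 0 := by exact_mod_cast hΩpos.ne'
  have hc0 : 0 < W.tamagawaProduct := W.tamagawaProduct_pos_holds
  have ht0 : 0 < W.torsionOrder := W.torsionOrder_pos_holds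
  have hq₀0 : q₀ ≠ 0 := by
    rintro rfl
    rw [Rat.cast_zero, div_eq_zero_iff] at hq₀
    exact hq₀.elim hL hΩ
  refine ⟨q₀ * (W.torsionOrder : ℚ) ^ 2 / (W.tamagawaProduct : ℚ), ?_, ?_⟩
  · have hcp : (W.tamagawaProduct : ℂ) ≠ 0 := by exact_mod_cast hc0.ne'
    have hLq : W.entireLFunction 1 = (q₀ : ℂ) * (W.realPeriodRat : ℂ) := by
      rw [← hq₀, div_mul_cancel₀ _ hΩ]
    rw [shaAn_def, leadingLCoeff_eq_of_analyticRank_eq_zero W hr,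
      W.regulator_eq_one_of_rank_zero hmw0, hLq]
    push_cast
    field_simp
  · have ht : (W.torsionOrder : ℚ) ≠ 0 := by exact_mod_cast ht0.ne'
    have hcq : (W.tamagawaProduct : ℚ) ≠ 0 := by exact_mod_cast hc0.ne'
    have hsha : padicValNat p (Nat.card (AddCommGroup.primaryComponent W.sha p)) =
        padicValNat p W.shaOrder := by
      unfold WeierstrassCurve.shaOrder
      exact padicValNat_card_addPrimaryComponent p
    have hv : padicValRat p (q₀ * (W.torsionOrder : ℚ) ^ 2 / (W.tamagawaProduct : ℚ)) =
        padicValRat p q₀ + 2 * (padicValNat p W.torsionOrder : ℤ) -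
          (padicValNat p W.tamagawaProduct : ℤ) := by
      rw [padicValRat.div (mul_ne_zero hq₀0 (pow_ne_zero 2 ht)) hcq,
        padicValRat.mul hq₀0 (pow_ne_zero 2 ht), pow_two, padicValRat.mul ht ht,
        padicValRat.of_nat, padicValRat.of_nat]
      ring
    rw [hv, ← hsha]
    linarith

/-- PORT of `X4RankZero.bsdp_of_shaAn_unit` to `p = 3`: **`BSD(E,3)` on X4 ∧ `r = 0` ∧ surj(9) ∧ non-exceptional ∧
`3 ∤ c_D · ∏ c_ℓ · ∏_{ℓ ‖ N}(ℓ ∓ 1) · #Ш_an`** from PUBLISHED theorems (KN20 + Rubin + Kato + KP, fact `hKN`; GZK; modularity)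
+ per-pair certificates. -/
theorem X4RankZero.bsdp_three_of_kimNakamura_of_shaAn_unit
    (hKN : KimNakamura2020.rankZero_padicValNat_sha_le_of_maninConstant)
    (hGZK : rank_eq_analyticRank_of_analyticRank_le_one) (hmod : hasEntireLFunction_rat)
    (hr : W.analyticRank = 0) (hX : ClassX4 W 3) (h9 : W.HasSurjectiveModNGaloisRep 9)
    (hexc : KimNakamura2020.NonExceptional W 3)
    (hmult : ∀ (ℓ : ℕ) [Fact ℓ.Prime], W.HasMultiplicativeReductionAtPrime ℓ →
      (W.HasSplitMultiplicativeReductionAtPrime ℓ → ¬ 3 ∣ ℓ - 1) ∧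
        (¬ W.HasSplitMultiplicativeReductionAtPrime ℓ → ¬ 3 ∣ ℓ + 1))
    {N : ℕ} [NeZero N] (D : ModularParametrizationData W N) (hc : ¬ (3 : ℤ) ∣ D.maninConstant)
    (htam : ¬ 3 ∣ W.tamagawaProduct) {q : ℚ} (hq : shaAn W = (q : ℂ)) (hv : padicValRat 3 q = 0) :
    BSDp W 3 := by
  haveI : Fact (Nat.Prime 3) := ⟨Nat.prime_three⟩
  refine bsdp_of_shaOrder_le_of_shaAn_unit W 3 hGZK (by rw [hr]; exact zero_le_one) ?_ htam hq hv
  obtain ⟨q', hq', hle⟩ := padicValNat_shaOrder_le_of_kimNakamura_rankZero W 3 hKN hGZK hmod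
    (by norm_num) hX.2.1 (Or.inr hexc) hr
    (WeierstrassCurve.forall_hasSurjectiveModNGaloisRep_three_pow_of_nine W h9) htam hmult D
    (by exact_mod_cast hc)
  refine ⟨q', hq', ?_⟩
  rw [padicValNat_torsionOrder_eq_zero_of_irreducible W 3 hX.2.2] at hle
  simpa using hle


/-- **The typed UPPER half at `p = 3` from Kim–Nakamura**: X4 ∧ `r = 0` ∧ `ρ̄_{E,3^n}` onto for all `n` ∧
non-exceptional ∧ `3 ∤ ∏ c_ℓ · ∏_{ℓ‖N}(ℓ ∓ 1)` ∧ `3 ∤ c_D` ⟹ `MissingUpperBoundAt W 3` — ANY additive type at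
`3`, potentially multiplicative included. [cite: KimNakamura2020, Thm. 4.2 (2), Cor. 2.4, Rem. 1.8 (1) (arXiv pp. 4–5, 9)]
[cite: Miller2011LMS, Def. 1.1] -/
theorem X4RankZero.missingUpperBoundAt_three_of_kimNakamura
    (hKN : KimNakamura2020.rankZero_padicValNat_sha_le_of_maninConstant)
    (hGZK : rank_eq_analyticRank_of_analyticRank_le_one) (hmod : hasEntireLFunction_rat)
    (hr : W.analyticRank = 0) (hX : ClassX4 W 3) (hsurj : ∀ n : ℕ, W.HasSurjectiveModNGaloisRep (3 ^ n : ℕ))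
    (hexc : KimNakamura2020.NonExceptional W 3)
    (hmult : ∀ (ℓ : ℕ) [Fact ℓ.Prime], W.HasMultiplicativeReductionAtPrime ℓ →
      (W.HasSplitMultiplicativeReductionAtPrime ℓ → ¬ 3 ∣ ℓ - 1) ∧
        (¬ W.HasSplitMultiplicativeReductionAtPrime ℓ → ¬ 3 ∣ ℓ + 1))
    {N : ℕ} [NeZero N] (D : ModularParametrizationData W N) (hc : ¬ (3 : ℤ) ∣ D.maninConstant)
    (htam : ¬ 3 ∣ W.tamagawaProduct) : MissingUpperBoundAt W 3 := by
  haveI : Fact (Nat.Prime 3) := ⟨Nat.prime_three⟩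
  obtain ⟨q', hq', hle⟩ := padicValNat_shaOrder_le_of_kimNakamura_rankZero W 3 hKN hGZK hmod
    (by norm_num) hX.2.1 (Or.inr hexc) hr hsurj htam hmult D (by exact_mod_cast hc)
  refine ⟨q', hq', ?_⟩
  rw [padicValNat_torsionOrder_eq_zero_of_irreducible W 3 hX.2.2,
    padicValNat.eq_zero_of_not_dvd htam] at hle
  simpa using hle

/-- **Census shape with the (ram) bit**: the `3`-adic surjectivity of the port fed by surj(3) ∧ ram(3) (a
multiplicative prime `ℓ ≠ 3` with `3 ∤ v_ℓ(Δ_min)`; tree theorem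
`hasSurjectiveModNGaloisRep_pow_of_hasMultiplicativeReductionAtPrime`) instead of surj(9): **`BSD(E,3)` on X4 ∧ `r = 0`
∧ surj(3) ∧ ram(3) ∧ non-exceptional ∧ `3 ∤ c_D · ∏ c_ℓ · ∏_{ℓ‖N}(ℓ ∓ 1) · #Ш_an`** — potentially multiplicative rows
included (the 79 window rows outside the Kato route). [cite: KimNakamura2020, Thm. 4.2 (2), Cor. 2.4, Rem. 1.8 (1) (arXiv pp. 4–5, 9)]
[cite: BurungaleSkinnerTianWan2024, Part II (sur), (ram) (p. 74)] [cite: Miller2011LMS, §1 and Def. 1.1] -/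
theorem X4RankZero.bsdp_three_of_kimNakamura_of_ram_of_shaAn_unit
    (hKN : KimNakamura2020.rankZero_padicValNat_sha_le_of_maninConstant)
    (hGZK : rank_eq_analyticRank_of_analyticRank_le_one) (hmod : hasEntireLFunction_rat)
    (hr : W.analyticRank = 0) (hX : ClassX4 W 3) (hsurj : Surj W 3) (hram : Ram W 3)
    (hexc : KimNakamura2020.NonExceptional W 3)
    (hmult : ∀ (ℓ : ℕ) [Fact ℓ.Prime], W.HasMultiplicativeReductionAtPrime ℓ →
      (W.HasSplitMultiplicativeReductionAtPrime ℓ → ¬ 3 ∣ ℓ - 1) ∧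
        (¬ W.HasSplitMultiplicativeReductionAtPrime ℓ → ¬ 3 ∣ ℓ + 1))
    {N : ℕ} [NeZero N] (D : ModularParametrizationData W N) (hc : ¬ (3 : ℤ) ∣ D.maninConstant)
    (htam : ¬ 3 ∣ W.tamagawaProduct) {q : ℚ} (hq : shaAn W = (q : ℂ)) (hv : padicValRat 3 q = 0) :
    BSDp W 3 := by
  haveI : Fact (Nat.Prime 3) := ⟨Nat.prime_three⟩
  refine bsdp_of_shaOrder_le_of_shaAn_unit W 3 hGZK (by rw [hr]; exact zero_le_one) ?_ htam hq hv
  obtain ⟨q', hq', hle⟩ := padicValNat_shaOrder_le_of_kimNakamura_rankZero W 3 hKN hGZK hmod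
    (by norm_num) hX.2.1 (Or.inr hexc) hr
    (hasSurjectiveModNGaloisRep_pow_of_hasMultiplicativeReductionAtPrime W 3 hsurj hram) htam hmult D
    (by exact_mod_cast hc)
  refine ⟨q', hq', ?_⟩
  rw [padicValNat_torsionOrder_eq_zero_of_irreducible W 3 hX.2.2] at hle
  simpa using hle

/-- **The `3 ∣ #Ш_an` rows on the KN20 route: Cassels–Tate squeeze from ONE 3-descent certificate.** X4 ∧ `r = 0`
∧ tower surjectivity ∧ non-exceptional ∧ `3 ∤ ∏ c_ℓ · ∏(ℓ ∓ 1)` ∧ `3 ∤ c_D`, `#Ш_an = q` with `ord_3 q ≤ 2k` and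
`3^{2k−1} ∣ #Ш(E)` ⟹ `BSD(E,3)` (upper half: the port; lower half: `Typed.missingLowerBoundAt_of_casselsTate_of_pow_dvd`).
[cite: KimNakamura2020, Thm. 4.2 (2), Cor. 2.4, Rem. 1.8 (1) (arXiv pp. 4–5, 9)] [cite: SilvermanAEC2009, Thm. X.4.14]
[cite: Miller2011LMS, §1 and Def. 1.1] -/
theorem X4RankZero.bsdp_three_of_kimNakamura_of_casselsTate
    (hKN : KimNakamura2020.rankZero_padicValNat_sha_le_of_maninConstant)
    (hGZK : rank_eq_analyticRank_of_analyticRank_le_one) (hmod : hasEntireLFunction_rat)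
    (hCT : exists_casselsTate_pairing (K := ℚ))
    (hr : W.analyticRank = 0) (hX : ClassX4 W 3) (hsurj : ∀ n : ℕ, W.HasSurjectiveModNGaloisRep (3 ^ n : ℕ))
    (hexc : KimNakamura2020.NonExceptional W 3)
    (hmult : ∀ (ℓ : ℕ) [Fact ℓ.Prime], W.HasMultiplicativeReductionAtPrime ℓ →
      (W.HasSplitMultiplicativeReductionAtPrime ℓ → ¬ 3 ∣ ℓ - 1) ∧
        (¬ W.HasSplitMultiplicativeReductionAtPrime ℓ → ¬ 3 ∣ ℓ + 1))
    {N : ℕ} [NeZero N] (D : ModularParametrizationData W N) (hc : ¬ (3 : ℤ) ∣ D.maninConstant)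
    (htam : ¬ 3 ∣ W.tamagawaProduct) {q : ℚ} (hq : shaAn W = (q : ℂ)) {k : ℕ}
    (hv : padicValRat 3 q ≤ 2 * k) (hdvd : 3 ^ (2 * k - 1) ∣ W.shaOrder) : BSDp W 3 := by
  haveI : Fact (Nat.Prime 3) := ⟨Nat.prime_three⟩
  exact bsdp_of_missingPPartAt W 3 hGZK (by rw [hr]; exact zero_le_one)
    (missingPPartAt_of_lower_of_upper W 3
      (missingLowerBoundAt_of_casselsTate_of_pow_dvd W 3 hCT (hGZK W (by rw [hr]; exact zero_le_one)).2
        hq hv hdvd)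
      (X4RankZero.missingUpperBoundAt_three_of_kimNakamura W hKN hGZK hmod hr hX hsurj hexc hmult D hc
        htam))

end Summit.BirchSwinnertonDyer.Rank1Residual.Additive

end
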